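import Mathlib
import Summits.NavierStokesRegularity.NavierStokesRegularity.Theses.VortexLineClock
import Literature.MathematicalPhysics.QuantumManyBody.NeumannCosineParseval
import HarnessLib

/-!
# `VortexLineClock.YorkePeriodBound` — Yorke's theorem: a closed orbit of an `L`-Lipschitz field
  has period `≥ 2π/L` (route `VortexLineClock`, item stmt-NavierStokesRegularity-11278, support)

**Theorem (Yorke 1969).** Let `F : ℝ³ → ℝ³` be `L`-Lipschitz and let `x : ℝ → ℝ³` be a
`τ`-periodic solution of `x' = F(x)` (`τ > 0`) which is not stationary (`F (x 0) ≠ 0`). Then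
`τ ≥ 2π/L`.

PROOF (Busenberg–Fisher–Martelli's Hilbert-space argument). Put `v = F ∘ x = x'` (continuous,
`τ`-periodic, `∫₀^τ v = x(τ) − x(0) = 0`) and `y = x − m`, `m` the mean of `x` over a period
(`C¹`, `τ`-periodic, mean zero, `y' = v`). For a mean-zero `h` one has the identity
`∫₀^τ ‖h(s) − h(t)‖² dt = τ‖h(s)‖² + ∫₀^τ‖h‖²` for every `s`; the Lipschitz bound
`‖v(s) − v(t)‖ ≤ L‖y(s) − y(t)‖` integrated in `t` and then in `s` gives `∫‖v‖² ≤ L² ∫‖y‖²`, and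
WIRTINGER's inequality for the mean-zero periodic `C¹` function `y` gives
`∫‖y‖² ≤ (τ/2π)² ∫‖y'‖² = (τ/2π)² ∫‖v‖²`. Since `v(0) ≠ 0`, `∫‖v‖² > 0`, whence `1 ≤ (Lτ/2π)²`.
Wirtinger's inequality is proved from PARSEVAL on an interval (Mathlib `hasSum_sq_fourierCoeffOn`)
and the integration-by-parts formula for Fourier coefficients (`fourierCoeffOn_of_hasDerivAt`):
`|ĉ(n)| = τ|ĉ'(n)|/(2π|n|)` for `n ≠ 0` and `ĉ(0) = 0`; componentwise for `ℝ³`-valued functions.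
(For `L = 0` the claim reads `0 ≤ τ` by Lean's `x/0 = 0`.)

References: J. A. Yorke, *Periods of periodic solutions and the Lipschitz constant*, Proc. AMS 22
(1969) 509–512; S. Busenberg, D. Fisher, M. Martelli, *Minimal periods of discrete and smooth
orbits*, Amer. Math. Monthly 96 (1989) 5–17 (the `2π/L` proof in Hilbert space via Wirtinger).

HONEST FRAMING: an elementary ODE fact (the route's "clock" brick); nothing here bears on the
regularity problem itself.
-/

noncomputable section

set_option linter.dupNamespace false

namespace Summit.NavierStokesRegularity.NavierStokesRegularity.Theorems

open MeasureTheory Set Filter Topology Complex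
open scoped Real
open Literature.MathematicalPhysics.QuantumManyBody.NeumannBox (memLp_two_Ioc_of_continuous)

namespace Yorke

/-! ### Wirtinger's inequality on an interval (complex-valued, via Parseval) -/

/-- The integration-by-parts factor: `‖1/(−2πin)‖ ≤ 1/(2π)` for `n ≠ 0`. [this file] -/
theorem norm_one_div_fourier_factor_le {n : ℤ} (hn : n ≠ 0) :
    ‖(1 : ℂ) / (-2 * π * I * n)‖ ≤ 1 / (2 * π) := by
  have h1 : (1 : ℝ) ≤ |(n : ℝ)| := by
    rw [← Int.cast_abs]; exact_mod_cast Int.one_le_abs hn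
  have hnorm : ‖(-2 * π * I * n : ℂ)‖ = 2 * π * |(n : ℝ)| := by
    rw [norm_mul, norm_mul, norm_mul, norm_neg, Complex.norm_I, mul_one, Complex.norm_real,
      Real.norm_of_nonneg Real.pi_pos.le, Complex.norm_intCast]
    norm_num
  rw [norm_div, norm_one, hnorm]
  apply div_le_div_of_nonneg_left zero_le_one (by positivity)
  nlinarith [Real.pi_pos]

/-- **Wirtinger's inequality** (complex-valued, period `b − a`): for `f` of class `C¹` on `ℝ` with
`f b = f a` and `∫ₐᵇ f = 0`, `∫ₐᵇ ‖f‖² ≤ ((b−a)/2π)² ∫ₐᵇ ‖f'‖²`. Parseval on `(a, b]`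
(`hasSum_sq_fourierCoeffOn`) for `f` and `f'`, with `ĉ_f(n) = (b−a)ĉ_{f'}(n)/(2πin)` (`n ≠ 0`,
`fourierCoeffOn_of_hasDerivAt`, periodicity) and `ĉ_f(0) = 0` (mean zero). [folklore; Wirtinger] -/
theorem wirtinger_complex {a b : ℝ} (hab : a < b) {f f' : ℝ → ℂ}
    (hf : ∀ x, HasDerivAt f (f' x) x) (hf' : Continuous f') (hper : f b = f a)
    (hmean : ∫ x in a..b, f x = 0) :
    ∫ x in a..b, ‖f x‖ ^ 2 ≤ ((b - a) / (2 * π)) ^ 2 * ∫ x in a..b, ‖f' x‖ ^ 2 := by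
  have hT : 0 < b - a := sub_pos.2 hab
  have hfc : Continuous f := continuous_iff_continuousAt.2 fun x => (hf x).continuousAt
  have hc := hasSum_sq_fourierCoeffOn hab (memLp_two_Ioc_of_continuous hfc)
  have hd := hasSum_sq_fourierCoeffOn hab (memLp_two_Ioc_of_continuous hf')
  set K : ℝ := ((b - a) / (2 * π)) ^ 2 with hK
  have key : ∀ n : ℤ, ‖fourierCoeffOn hab f n‖ ^ 2 ≤ K * ‖fourierCoeffOn hab f' n‖ ^ 2 := by
    intro n
    rcases eq_or_ne n 0 with rfl | hn
    · have h0 : fourierCoeffOn hab f 0 = 0 := by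
        rw [fourierCoeffOn_eq_integral]
        simp only [neg_zero, fourier_zero, one_smul, hmean, smul_zero]
      rw [h0, norm_zero, zero_pow two_ne_zero, hK]
      positivity
    · rw [fourierCoeffOn_of_hasDerivAt hab hn (fun x _ => hf x) (hf'.intervalIntegrable _ _), hper,
        sub_self, mul_zero, zero_sub, norm_mul, norm_neg, norm_mul]
      have hA := norm_one_div_fourier_factor_le hn
      have hB : ‖((b : ℂ) - a)‖ = b - a := by
        rw [← Complex.ofReal_sub, Complex.norm_real, Real.norm_of_nonneg hT.le]
      rw [hB, hK]
      have hdn := norm_nonneg (fourierCoeffOn hab f' n)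
      have hA0 : 0 ≤ ‖(1 : ℂ) / (-2 * π * I * n)‖ := norm_nonneg _
      calc (‖(1 : ℂ) / (-2 * π * I * n)‖ * ((b - a) * ‖fourierCoeffOn hab f' n‖)) ^ 2
          = ‖(1 : ℂ) / (-2 * π * I * n)‖ ^ 2 * ((b - a) ^ 2 * ‖fourierCoeffOn hab f' n‖ ^ 2) := by
            ring
        _ ≤ (1 / (2 * π)) ^ 2 * ((b - a) ^ 2 * ‖fourierCoeffOn hab f' n‖ ^ 2) := by
            gcongr
        _ = ((b - a) / (2 * π)) ^ 2 * ‖fourierCoeffOn hab f' n‖ ^ 2 := by ring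
  have hle := hasSum_le key hc (hd.mul_left K)
  simp only [smul_eq_mul] at hle
  calc ∫ x in a..b, ‖f x‖ ^ 2 = (b - a) * ((b - a)⁻¹ * ∫ x in a..b, ‖f x‖ ^ 2) := by
        rw [mul_inv_cancel_left₀ hT.ne']
    _ ≤ (b - a) * (K * ((b - a)⁻¹ * ∫ x in a..b, ‖f' x‖ ^ 2)) :=
        mul_le_mul_of_nonneg_left hle hT.le
    _ = K * ∫ x in a..b, ‖f' x‖ ^ 2 := by
        field_simp

/-- **Wirtinger's inequality, real-valued.** [folklore; Wirtinger] -/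
theorem wirtinger_real {a b : ℝ} (hab : a < b) {g g' : ℝ → ℝ}
    (hg : ∀ x, HasDerivAt g (g' x) x) (hg' : Continuous g') (hper : g b = g a)
    (hmean : ∫ x in a..b, g x = 0) :
    ∫ x in a..b, g x ^ 2 ≤ ((b - a) / (2 * π)) ^ 2 * ∫ x in a..b, g' x ^ 2 := by
  have h := wirtinger_complex hab (f := fun x => (g x : ℂ)) (f' := fun x => (g' x : ℂ))
    (fun x => (hg x).ofReal_comp) (Complex.continuous_ofReal.comp hg') (by simp [hper])
    (by rw [intervalIntegral.integral_ofReal, hmean]; simp)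
  simp only [Complex.norm_real, Real.norm_eq_abs, sq_abs] at h
  exact h

/-- **Wirtinger's inequality for `ℝ³`-valued functions** (componentwise): `y` of class `C¹` with
`y' = v` continuous, `y b = y a`, `∫ₐᵇ y = 0` ⇒ `∫ₐᵇ ‖y‖² ≤ ((b−a)/2π)² ∫ₐᵇ ‖v‖²`. [folklore; Wirtinger] -/
theorem wirtinger_euclidean {a b : ℝ} (hab : a < b)
    {y v : ℝ → EuclideanSpace ℝ (Fin 3)}
    (hy : ∀ s, HasDerivAt y (v s) s) (hv : Continuous v) (hper : y b = y a)
    (hmean : ∫ s in a..b, y s = 0) :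
    ∫ s in a..b, ‖y s‖ ^ 2 ≤ ((b - a) / (2 * π)) ^ 2 * ∫ s in a..b, ‖v s‖ ^ 2 := by
  have hyc : Continuous y := continuous_iff_continuousAt.2 fun s => (hy s).continuousAt
  -- componentwise data
  have hyi : ∀ i s, HasDerivAt (fun s => y s i) (v s i) s := by
    intro i s
    have h := (EuclideanSpace.proj (𝕜 := ℝ) (ι := Fin 3) i).hasFDerivAt.comp_hasDerivAt s (hy s)
    exact h
  have hvi : ∀ i, Continuous fun s => v s i := fun i => (EuclideanSpace.proj i).continuous.comp hv
  have hyci : ∀ i, Continuous fun s => y s i := fun i => (EuclideanSpace.proj i).continuous.comp hyc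
  have hperi : ∀ i, y b i = y a i := fun i => by rw [hper]
  have hmeani : ∀ i, ∫ s in a..b, y s i = 0 := by
    intro i
    have h := (EuclideanSpace.proj (𝕜 := ℝ) i).intervalIntegral_comp_comm
      (hyc.intervalIntegrable (μ := volume) a b)
    rw [hmean, map_zero] at h
    exact h
  have hW : ∀ i, ∫ s in a..b, (y s i) ^ 2 ≤ ((b - a) / (2 * π)) ^ 2 * ∫ s in a..b, (v s i) ^ 2 :=
    fun i => wirtinger_real hab (hyi i) (hvi i) (hperi i) (hmeani i)
  -- sum over components
  have e1 : ∫ s in a..b, ‖y s‖ ^ 2 = ∑ i, ∫ s in a..b, (y s i) ^ 2 := by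
    rw [← intervalIntegral.integral_finsetSum]
    · exact intervalIntegral.integral_congr fun s _ => EuclideanSpace.real_norm_sq_eq (y s)
    · exact fun i _ => by apply Continuous.intervalIntegrable; fun_prop
  have e2 : ∫ s in a..b, ‖v s‖ ^ 2 = ∑ i, ∫ s in a..b, (v s i) ^ 2 := by
    rw [← intervalIntegral.integral_finsetSum]
    · exact intervalIntegral.integral_congr fun s _ => EuclideanSpace.real_norm_sq_eq (v s)
    · exact fun i _ => by apply Continuous.intervalIntegrable; fun_prop
  rw [e1, e2, Finset.mul_sum]
  exact Finset.sum_le_sum fun i _ => hW i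

/-! ### The double-integral identity and the Lipschitz comparison -/

/-- For a continuous `h` with `∫ₐᵇ h = 0`: `∫ₐᵇ ‖h s − h t‖² dt = (b − a)‖h s‖² + ∫ₐᵇ ‖h‖²`.
[this file] -/
theorem integral_norm_sub_sq_eq {a b : ℝ} {h : ℝ → EuclideanSpace ℝ (Fin 3)}
    (hc : Continuous h) (hmean : ∫ t in a..b, h t = 0) (s : ℝ) :
    ∫ t in a..b, ‖h s - h t‖ ^ 2 = (b - a) * ‖h s‖ ^ 2 + ∫ t in a..b, ‖h t‖ ^ 2 := by
  have hexp : ∀ t, ‖h s - h t‖ ^ 2 = ‖h s‖ ^ 2 - 2 * inner ℝ (h s) (h t) + ‖h t‖ ^ 2 := by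
    intro t
    rw [@norm_sub_sq_real]
  simp_rw [hexp]
  have i1 : IntervalIntegrable (fun _ : ℝ => ‖h s‖ ^ 2) volume a b := intervalIntegrable_const
  have i2 : IntervalIntegrable (fun t => 2 * inner ℝ (h s) (h t)) volume a b := by
    apply Continuous.intervalIntegrable; fun_prop
  have i3 : IntervalIntegrable (fun t => ‖h t‖ ^ 2) volume a b := by
    apply Continuous.intervalIntegrable; fun_prop
  have hin : ∫ t in a..b, inner ℝ (h s) (h t) = inner ℝ (h s) (∫ t in a..b, h t) := by
    have h1 := (innerSL ℝ (h s)).intervalIntegral_comp_comm (hc.intervalIntegrable (μ := volume) a b)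
    simpa only [innerSL_apply_apply] using h1
  rw [intervalIntegral.integral_add (i1.sub i2) i3, intervalIntegral.integral_sub i1 i2,
    intervalIntegral.integral_const, intervalIntegral.integral_const_mul, hin, hmean, inner_zero_right,
    mul_zero, sub_zero, smul_eq_mul]

/-- **The Lipschitz comparison**: if `‖v s − v t‖ ≤ L‖y s − y t‖` for all `s, t`, both continuous
with zero mean on `[a, b]`, then `∫ₐᵇ ‖v‖² ≤ L² ∫ₐᵇ ‖y‖²`. [this file] -/
theorem integral_norm_sq_le_of_lipschitz_compare {a b : ℝ} (hab : a < b)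
    {y v : ℝ → EuclideanSpace ℝ (Fin 3)} (hyc : Continuous y) (hvc : Continuous v)
    (hymean : ∫ t in a..b, y t = 0) (hvmean : ∫ t in a..b, v t = 0) {L : ℝ}
    (hlip : ∀ s t, ‖v s - v t‖ ≤ L * ‖y s - y t‖) :
    ∫ t in a..b, ‖v t‖ ^ 2 ≤ L ^ 2 * ∫ t in a..b, ‖y t‖ ^ 2 := by
  set Ev : ℝ := ∫ t in a..b, ‖v t‖ ^ 2 with hEv
  set Ey : ℝ := ∫ t in a..b, ‖y t‖ ^ 2 with hEy
  -- pointwise in `s`: `(b−a)‖v s‖² + Ev ≤ L²((b−a)‖y s‖² + Ey)`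
  have hs : ∀ s, (b - a) * ‖v s‖ ^ 2 + Ev ≤ L ^ 2 * ((b - a) * ‖y s‖ ^ 2 + Ey) := by
    intro s
    rw [hEv, hEy, ← integral_norm_sub_sq_eq hvc hvmean s,
      ← integral_norm_sub_sq_eq hyc hymean s, ← intervalIntegral.integral_const_mul]
    refine intervalIntegral.integral_mono_on hab.le
      (by apply Continuous.intervalIntegrable; fun_prop)
      (by apply Continuous.intervalIntegrable; fun_prop)
      fun t _ => ?_
    have h1 := hlip s t
    have h2 : 0 ≤ ‖v s - v t‖ := norm_nonneg _
    calc ‖v s - v t‖ ^ 2 ≤ (L * ‖y s - y t‖) ^ 2 := pow_le_pow_left₀ h2 h1 2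
      _ = L ^ 2 * ‖y s - y t‖ ^ 2 := by ring
  -- integrate in `s`
  have hintL : IntervalIntegrable (fun s => (b - a) * ‖v s‖ ^ 2 + Ev) volume a b := by
    apply Continuous.intervalIntegrable; fun_prop
  have hintR : IntervalIntegrable (fun s => L ^ 2 * ((b - a) * ‖y s‖ ^ 2 + Ey)) volume a b := by
    apply Continuous.intervalIntegrable; fun_prop
  have hI := intervalIntegral.integral_mono_on hab.le hintL hintR fun s _ => hs s
  have iv : IntervalIntegrable (fun s => (b - a) * ‖v s‖ ^ 2) volume a b := by
    apply Continuous.intervalIntegrable; fun_prop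
  have iy : IntervalIntegrable (fun s => (b - a) * ‖y s‖ ^ 2) volume a b := by
    apply Continuous.intervalIntegrable; fun_prop
  have eL : ∫ s in a..b, ((b - a) * ‖v s‖ ^ 2 + Ev) = (b - a) * Ev + (b - a) * Ev := by
    rw [intervalIntegral.integral_add iv intervalIntegrable_const, intervalIntegral.integral_const_mul,
      intervalIntegral.integral_const, smul_eq_mul]
  have eR : ∫ s in a..b, L ^ 2 * ((b - a) * ‖y s‖ ^ 2 + Ey) =
      L ^ 2 * ((b - a) * Ey + (b - a) * Ey) := by
    rw [intervalIntegral.integral_const_mul, intervalIntegral.integral_add iy intervalIntegrable_const,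
      intervalIntegral.integral_const_mul, intervalIntegral.integral_const, smul_eq_mul]
  rw [eL, eR] at hI
  have hT : 0 < b - a := sub_pos.2 hab
  have h2 : 2 * (b - a) * Ev ≤ 2 * (b - a) * (L ^ 2 * Ey) := by linarith
  exact le_of_mul_le_mul_left h2 (by positivity)

end Yorke

open Yorke in
/-- **Item stmt-NavierStokesRegularity-11278** (`VortexLineClock.YorkePeriodBound`; Yorke 1969): a
non-stationary `τ`-periodic solution of `x' = F(x)` with `F` `L`-Lipschitz on `ℝ³` has
`τ ≥ 2π/L`. [this file; Yorke 1969 / Busenberg–Fisher–Martelli 1989] -/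
theorem vortexLineClock_yorkePeriodBound_proof :
    Summit.NavierStokesRegularity.NavierStokesRegularity.Theses.VortexLineClock.YorkePeriodBound := by
  unfold Summit.NavierStokesRegularity.NavierStokesRegularity.Theses.VortexLineClock.YorkePeriodBound
  intro F L hF x τ hτ hx hper h0
  by_cases hL0 : (L : ℝ) = 0
  · rw [hL0, div_zero]; exact hτ.le
  have hLpos : 0 < (L : ℝ) := lt_of_le_of_ne L.2 (Ne.symm hL0)
  -- `v = x' = F ∘ x`
  set v : ℝ → EuclideanSpace ℝ (Fin 3) := fun s => F (x s) with hv
  have hxc : Continuous x := continuous_iff_continuousAt.2 fun s => (hx s).continuousAt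
  have hvc : Continuous v := hF.continuous.comp hxc
  have hxτ : x τ = x 0 := by simpa using hper 0
  have hv_mean : ∫ s in (0 : ℝ)..τ, v s = 0 := by
    rw [intervalIntegral.integral_eq_sub_of_hasDerivAt (fun s _ => hx s) (hvc.intervalIntegrable _ _),
      hxτ, sub_self]
  -- `y = x − mean`
  set m : EuclideanSpace ℝ (Fin 3) := τ⁻¹ • ∫ s in (0 : ℝ)..τ, x s with hm
  set y : ℝ → EuclideanSpace ℝ (Fin 3) := fun s => x s - m with hy
  have hyd : ∀ s, HasDerivAt y (v s) s := fun s => (hx s).sub_const m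
  have hyc : Continuous y := hxc.sub continuous_const
  have hy_per : y τ = y 0 := by simp only [hy, hxτ]
  have hy_mean : ∫ s in (0 : ℝ)..τ, y s = 0 := by
    simp only [hy]
    rw [intervalIntegral.integral_sub (hxc.intervalIntegrable _ _) intervalIntegrable_const,
      intervalIntegral.integral_const, sub_zero, hm, smul_smul, mul_inv_cancel₀ hτ.ne', one_smul,
      sub_self]
  -- Wirtinger for `y` and the Lipschitz comparison
  have hW := wirtinger_euclidean hτ hyd hvc hy_per hy_mean
  rw [sub_zero] at hW
  have hlip : ∀ s t, ‖v s - v t‖ ≤ L * ‖y s - y t‖ := by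
    intro s t
    have h := hF.dist_le_mul (x s) (x t)
    rw [dist_eq_norm, dist_eq_norm] at h
    have e : y s - y t = x s - x t := by simp only [hy]; abel
    rw [e]
    exact h
  have hC := integral_norm_sq_le_of_lipschitz_compare hτ hyc hvc hy_mean hv_mean hlip
  -- `∫‖v‖² > 0`
  have hv0 : 0 < ‖v 0‖ ^ 2 := by
    have : v 0 ≠ 0 := h0
    positivity
  have hpos : 0 < ∫ s in (0 : ℝ)..τ, ‖v s‖ ^ 2 := by
    have h := intervalIntegral.integral_lt_integral_of_continuousOn_of_le_of_exists_lt hτ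
      continuousOn_const (by fun_prop) (fun s _ => sq_nonneg ‖v s‖)
      ⟨0, ⟨le_rfl, hτ.le⟩, hv0⟩
    simpa using h
  -- combine
  set Ev : ℝ := ∫ s in (0 : ℝ)..τ, ‖v s‖ ^ 2 with hEv
  set Ey : ℝ := ∫ s in (0 : ℝ)..τ, ‖y s‖ ^ 2 with hEy
  have hq0 : 0 ≤ (L : ℝ) * τ / (2 * π) := by positivity
  have h1 : Ev ≤ ((L : ℝ) * τ / (2 * π)) ^ 2 * Ev := by
    have h2 : (L : ℝ) ^ 2 * Ey ≤ (L : ℝ) ^ 2 * ((τ / (2 * π)) ^ 2 * Ev) :=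
      mul_le_mul_of_nonneg_left hW (sq_nonneg _)
    calc Ev ≤ (L : ℝ) ^ 2 * Ey := hC
      _ ≤ (L : ℝ) ^ 2 * ((τ / (2 * π)) ^ 2 * Ev) := h2
      _ = ((L : ℝ) * τ / (2 * π)) ^ 2 * Ev := by ring
  have h3 : 1 ≤ ((L : ℝ) * τ / (2 * π)) ^ 2 := by
    by_contra hlt
    push Not at hlt
    nlinarith
  have h4 : 1 ≤ (L : ℝ) * τ / (2 * π) := by
    by_contra hlt
    push Not at hlt
    have : ((L : ℝ) * τ / (2 * π)) ^ 2 < 1 := by nlinarith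
    linarith
  rw [le_div_iff₀ (by positivity), one_mul] at h4
  rw [div_le_iff₀ hLpos]
  linarith

end Summit.NavierStokesRegularity.NavierStokesRegularity.Theorems

end
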